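import Summits.AtomisticToContinuum.HydrodynamicLimit.Theorems.InformationPercolationEnginePercolationClosesChaosCesaroNbhdSupport
import Summits.AtomisticToContinuum.HydrodynamicLimit.Theorems.InformationPercolationEnginePercolationClosesChaosCesaroStaticAssembly
import HarnessLib

/-!
# Red-team probes of the re-typed statements of skeleton v5 (line `equilibrium-forecast-chain-rule`, crux
`InformationPercolationEngine.PercolationClosesChaos`, stmt-AtomisticToContinuum-15178) — audit certificates

Support file (`--supports stmt-AtomisticToContinuum-15178`) of the cycle-4 red-team audit (worker W5 of lead c3) of the four
re-typed statements of `…ForecastRetyped.lean` — `MesoStaticMaxwellRarity` (1), `MesoForecastChaos` (2),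
`NoKineticIrregularity` (3), `NoMesoscopicOscillationR` (4). Nothing is asserted about them; this file pins in Lean the
SEMANTIC facts the audit's verdicts ("all four stand as typed") rest on, over the landed vocabulary (`…ForecastDefs`,
`…DockingCells`, `…CesaroTelescoping`, `…CesaroNbhdSupport`, `…CesaroStaticAssembly`):

* Junk channels closed. The four unit-indexed summands are FINITELY SUPPORTED in the cell index for every phase point —
  `mesoStatic_summand_eq_zero_of_not_mem` (1), `mfc_summand_eq_zero_of_not_mem` (2), `nki_summand_eq_zero_of_not_mem` (3),
  `nmoR_summand_eq_zero_of_not_mem` / `nmoR_inner_tsum_eq_sum` (4) — so every `unitAvg` in the four statements is the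
  finite box sum (registered headline `mesoStatic_unitAvg_eq_sum` for (1)), never the junk `tsum = 0` that voided
  `NoMesoscopicOscillation` (ii) (`unitAvg_nbhd_inhom_eq_zero`). The invariant law of an over-packed diameter is the ZERO
  measure (`localGibbsLaw_eq_zero_of_partition_eq_zero`) — harmless for (1)/(2), whose `∀ σ ≤ σ₁` includes the small
  diameters where it is a probability measure.
* Blind spots of the cutoffs (the facts behind the macrostate attacks of the kill records): `inhom_self` and
  `regular_of_nbhd_eq_pop` (an isolated cluster — `nbhd = pop` — is `Regular` for EVERY `ϑh ≥ 0`: the isolated pairs of the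
  (b)-kill), `relEnt_eq_zero_of_forall_vel_eq` (a population with identical velocities is exactly Maxwellian at every
  resolution `ϑs ≠ 0`: `relEnt` is blind below `ϑs`, so cold structures never count in (1)), `goodUnit_congr` (`GoodUnit`
  reads the configuration only through cell labels and velocities: sub-cell geometry is invisible, the content of (2) is in
  its forecast conjunct), `goodUnit_of_pop_empty_of_nbhd_empty` (void units are good — and weightless),
  `inhom_empty_left` / `not_regular_of_pop_empty` (an empty cell with a populated neighbourhood has `inhom = 1`: irregular
  for `ϑh < 1`, counted by (3)).
-/
noncomputable section

open MeasureTheory Set Filter Topology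
open scoped ENNReal BigOperators Classical
open Literature.Analysis.FluidPDE Literature.MathematicalPhysics.KineticTheory
open Literature.MathematicalPhysics.KineticTheory.VelocityBlindPlacement

namespace Summit.AtomisticToContinuum.HydrodynamicLimit.Theorems.EquilibriumForecastLine

/-! ## Blind spots of `inhom`, `Regular`, `relEnt`, `GoodUnit` -/

/-- A population is perfectly homogeneous against itself: `inhom ϑ w P P = 0`. [folklore] -/
theorem inhom_self {N : ℕ} (ϑ : ℝ) (w : Phase N) (P : Finset (Fin (N + 1))) : inhom ϑ w P P = 0 := by
  simp [inhom]

/-- `inhom ≥ 0`. [folklore] -/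
theorem inhom_nonneg {N : ℕ} (ϑ : ℝ) (w : Phase N) (P Q : Finset (Fin (N + 1))) : 0 ≤ inhom ϑ w P Q :=
  integral_nonneg fun _ => abs_nonneg _

/-- **Isolated clusters are regular, whatever the homogeneity threshold.** If the `4h`-neighbourhood of `q` holds exactly the
population of `q` (an isolated pair / cluster of the kill record) and the neighbourhood is not packed, then `q` is
`Regular ϑs ϑh φs` for EVERY `ϑh ≥ 0`. [folklore] -/
theorem regular_of_nbhd_eq_pop {N : ℕ} {ϑs ϑh φs c σ : ℝ} {w : Phase N} {q : Cell} (hD : ¬ Dense φs c σ N w q)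
    (h : nbhd c σ N w q = pop c σ N w q) (hϑh : 0 ≤ ϑh) : Regular ϑs ϑh φs c σ N w q := by
  refine ⟨hD, ?_⟩
  rw [h, inhom_self]
  exact hϑh

/-- `Dense` reads the neighbourhood only through its CARDINALITY (no geometry): unfolding. [folklore] -/
theorem dense_iff_card {N : ℕ} (φs c σ : ℝ) (w : Phase N) (q : Cell) :
    Dense φs c σ N w q ↔ φs * (4 / 3 * Real.pi * (4 * (c * meanFreePath σ N)) ^ 3) <
      ((nbhd c σ N w q).card : ℝ) * (Real.pi / 6 * hsDiameter σ N ^ 3) := Iff.rfl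

/-- **`relEnt` is blind below the resolution `ϑs`**: a population whose velocities are all EQUAL (a cold beam / cold cluster)
has smoothed relative entropy exactly `0` (`kde = M_{1,u,ϑs²}`, `meanVel = u`, `temp = 0`, reference `M_{1,u,0+ϑs²}`), for every
`ϑs ≠ 0`. So no cold structure is ever `ϑ`-non-Maxwellian in `MesoStaticMaxwellRarity`. [folklore] -/
theorem relEnt_eq_zero_of_forall_vel_eq {N : ℕ} {ϑs : ℝ} (hϑs : ϑs ≠ 0) (w : Phase N) {P : Finset (Fin (N + 1))} {u : V3}
    (hu : ∀ i ∈ P, (w i).2 = u) : relEnt ϑs w P = 0 := by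
  rcases P.eq_empty_or_nonempty with rfl | hP
  · exact relEnt_empty ϑs w
  have hcard : (P.card : ℝ) ≠ 0 := Nat.cast_ne_zero.2 hP.card_pos.ne'
  have hθ : 0 < ϑs ^ 2 := by positivity
  have hkde : ∀ v, kde ϑs w P v = localMaxwellian 1 (ϑs ^ 2) u v := by
    intro v
    unfold kde
    rw [Finset.sum_congr rfl fun i hi => by rw [hu i hi], Finset.sum_const, nsmul_eq_mul, ← mul_assoc,
      inv_mul_cancel₀ hcard, one_mul]
  have hmean : meanVel w P = u := by
    unfold meanVel
    rw [Finset.sum_congr rfl fun i hi => by rw [hu i hi], Finset.sum_const, ← Nat.cast_smul_eq_nsmul ℝ, smul_smul,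
      inv_mul_cancel₀ hcard, one_smul]
  have htemp : temp w P = 0 := by
    unfold temp
    rw [hmean, Finset.sum_eq_zero fun i hi => by rw [hu i hi, sub_self, norm_zero]; ring, mul_zero]
  unfold relEnt
  simp_rw [hkde, hmean, htemp, zero_add]
  have h1 : ∀ v, localMaxwellian 1 (ϑs ^ 2) u v / localMaxwellian 1 (ϑs ^ 2) u v = 1 := fun v =>
    div_self (localMaxwellian_pos one_pos hθ u v).ne'
  simp_rw [h1, Real.log_one, mul_zero, integral_zero]

/-- `inhom` of the EMPTY population against a populated one is `1` (`kde ∅ = 0`, `∫ kde Q = 1`; `ϑs ≠ 0`). [folklore] -/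
theorem inhom_empty_left {N : ℕ} {ϑs : ℝ} (hϑs : ϑs ≠ 0) (w : Phase N) {Q : Finset (Fin (N + 1))} (hQ : Q.Nonempty) :
    inhom ϑs w ∅ Q = 1 := by
  unfold inhom
  have h1 : ∀ v, |kde ϑs w ∅ v - kde ϑs w Q v| = kde ϑs w Q v := by
    intro v
    rw [kde_empty_eq, zero_sub, abs_neg, abs_of_nonneg]
    exact kde_nonneg _ (fun i => (w i).2) ϑs v
  simp_rw [h1]
  exact integral_kde_eq_one hQ (fun i => (w i).2) hϑs

/-- `inhom` of two EMPTY populations is `0` (a void cell in a void neighbourhood is perfectly homogeneous). [folklore] -/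
theorem inhom_empty_empty {N : ℕ} (ϑs : ℝ) (w : Phase N) : inhom ϑs w ∅ ∅ = 0 := inhom_self ϑs w ∅

/-- **An empty cell with a populated neighbourhood is irregular for every threshold `ϑh < 1`** (it counts in
`NoKineticIrregularity` with `inhom = 1`; in particular a JUNK index `q ∉ cellBox` with a wrapped-around populated neighbourhood
is never `Regular` unless the prover takes `ϑh ≥ 1`). [folklore] -/
theorem not_regular_of_pop_empty {N : ℕ} {ϑs ϑh φs c σ : ℝ} (hϑs : ϑs ≠ 0) (hϑh : ϑh < 1) {w : Phase N} {q : Cell}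
    (hp : pop c σ N w q = ∅) (hn : (nbhd c σ N w q).Nonempty) : ¬ Regular ϑs ϑh φs c σ N w q := by
  rintro ⟨-, hI⟩
  rw [hp, inhom_empty_left hϑs w hn] at hI
  linarith

/-- Conversely, with `ϑh ≥ 1` EVERY non-packed cell is regular (`inhom ≤ ∫ kde + ∫ kde ≤ …` is not even needed: for an empty
cell `inhom = 1 ≤ ϑh`), so a prover's `ϑh ≥ 1` makes junk indices regular — harmless in (1), whose summand also demands
`ϑ ≤ relEnt ∅ = 0`, see `mesoStatic_summand_eq_zero_of_pop_empty`. [folklore] -/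
theorem regular_of_pop_empty_of_one_le {N : ℕ} {ϑs ϑh φs c σ : ℝ} (hϑs : ϑs ≠ 0) (hϑh : 1 ≤ ϑh) {w : Phase N} {q : Cell}
    (hD : ¬ Dense φs c σ N w q) (hp : pop c σ N w q = ∅) (hn : (nbhd c σ N w q).Nonempty) :
    Regular ϑs ϑh φs c σ N w q := by
  refine ⟨hD, ?_⟩
  rw [hp, inhom_empty_left hϑs w hn]
  exact hϑh

/-- **Void units are good.** A cell with empty population AND empty `4h`-neighbourhood is `GoodUnit ϑs ϑ φs` for every
`ϑ ≥ 0`, `φs > 0`, `h > 0` (`¬Dense`: `0 < φs · vol`, `card nbhd = 0`; `inhom ∅ ∅ = 0`; `relEnt ∅ = 0`). Harmless in (2): such a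
unit owns no collision, `badWeight = 0`. [folklore] -/
theorem goodUnit_of_pop_empty_of_nbhd_empty {N : ℕ} {ϑs ϑ φs c σ : ℝ} (hφs : 0 < φs) (hh : 0 < c * meanFreePath σ N)
    (hϑ : 0 ≤ ϑ) {w : Phase N} {q : Cell} (hp : pop c σ N w q = ∅) (hn : nbhd c σ N w q = ∅) :
    GoodUnit ϑs ϑ φs c σ N w q := by
  refine ⟨⟨?_, ?_⟩, ?_⟩
  · unfold Dense
    rw [hn, Finset.card_empty, Nat.cast_zero, zero_mul, not_lt]
    positivity
  · rw [hp, hn, inhom_empty_empty]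
    exact hϑ
  · rw [hp, relEnt_empty]
    exact hϑ

/-- **`GoodUnit` sees no sub-cell geometry.** Two configurations with the same cell labels and the same velocities have the
same good units (`pop`, `nbhd`, `kde`, `meanVel`, `temp`, hence `Dense`, `inhom`, `relEnt` agree): droplets, chains or
converging streams INSIDE cells are invisible to the cutoff — the content of (2) is entirely in the FORECAST conjunct.
[folklore] -/
theorem goodUnit_congr {N : ℕ} (ϑs ϑ φs c σ : ℝ) {w w' : Phase N} (hc : ∀ i, cellOf c σ N (w i).1 = cellOf c σ N (w' i).1)
    (hv : ∀ i, (w i).2 = (w' i).2) (q : Cell) : GoodUnit ϑs ϑ φs c σ N w q ↔ GoodUnit ϑs ϑ φs c σ N w' q := by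
  have hpop : pop c σ N w q = pop c σ N w' q := by
    unfold pop
    exact Finset.filter_congr fun i _ => by rw [hc i]
  have hnbhd : nbhd c σ N w q = nbhd c σ N w' q := by
    unfold nbhd
    exact Finset.filter_congr fun i _ => by rw [hc i]
  have hkde : kde ϑs w = kde ϑs w' := by
    funext P v
    unfold kde
    rw [Finset.sum_congr rfl fun i _ => by rw [hv i]]
  have hmean : meanVel w = meanVel w' := by
    funext P
    unfold meanVel
    rw [Finset.sum_congr rfl fun i _ => by rw [hv i]]
  have htemp : temp w = temp w' := by
    funext P
    unfold temp
    rw [hmean, Finset.sum_congr rfl fun i _ => by rw [hv i]]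
  have hrel : relEnt ϑs w = relEnt ϑs w' := by
    funext P
    unfold relEnt
    rw [hkde, hmean, htemp]
  have hinh : inhom ϑs w = inhom ϑs w' := by
    funext P Q
    unfold inhom
    rw [hkde]
  unfold GoodUnit Regular Dense
  rw [hpop, hnbhd, hrel, hinh]

/-! ## A. Finite support of the four summands (no junk `tsum`) -/

/-- **(1) `MesoStaticMaxwellRarity`'s summand vanishes on every EMPTY cell**, for every floor `m₀` and every `ϑ > 0`
(`m₀ = 0` included: then `ϑ ≤ relEnt ∅ = 0` fails). [folklore] -/
theorem mesoStatic_summand_eq_zero_of_pop_empty {σ : ℝ} {N : ℕ} (Φ : Flow σ N) (ϑs ϑh φs c : ℝ) (m₀ : ℕ) {ϑ : ℝ}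
    (hϑ : 0 < ϑ) (k : ℕ) (z : Phase N) {q : Cell}
    (hq : pop c σ N (Φ.flow ((k : ℝ) * stepLen c σ N) z) q = ∅) :
    (if Regular ϑs ϑh φs c σ N (Φ.flow ((k : ℝ) * stepLen c σ N) z) q ∧
        m₀ ≤ (pop c σ N (Φ.flow ((k : ℝ) * stepLen c σ N) z) q).card ∧
        ϑ ≤ relEntAt ϑs c σ N Φ ((k : ℝ) * stepLen c σ N) q z then (1 : ℝ) else 0) = 0 := by
  rw [if_neg]
  rintro ⟨-, -, h3⟩
  have hne := pop_nonempty_of_relEntAt_pos Φ (hϑ.trans_le h3)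
  rw [hq] at hne
  exact Finset.not_nonempty_empty hne

/-- **(1) is box-supported**: off `cellBox h` the summand of `MesoStaticMaxwellRarity` is `0` for every phase point (so its
`unitAvg` is the finite box sum, `unitAvg_eq_sum`). [folklore] -/
theorem mesoStatic_summand_eq_zero_of_not_mem {σ : ℝ} {N : ℕ} {c : ℝ} (hh : 0 < c * meanFreePath σ N) (Φ : Flow σ N)
    (ϑs ϑh φs : ℝ) (m₀ : ℕ) {ϑ : ℝ} (hϑ : 0 < ϑ) (k : ℕ) (z : Phase N) {q : Cell}
    (hq : q ∉ cellBox (c * meanFreePath σ N)) :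
    (if Regular ϑs ϑh φs c σ N (Φ.flow ((k : ℝ) * stepLen c σ N) z) q ∧
        m₀ ≤ (pop c σ N (Φ.flow ((k : ℝ) * stepLen c σ N) z) q).card ∧
        ϑ ≤ relEntAt ϑs c σ N Φ ((k : ℝ) * stepLen c σ N) q z then (1 : ℝ) else 0) = 0 :=
  mesoStatic_summand_eq_zero_of_pop_empty Φ ϑs ϑh φs c m₀ hϑ k z (pop_eq_empty_of_not_mem hh _ hq)

/-- **Registered headline `mesoStatic_unitAvg_eq_sum` (audit certificate for `MesoStaticMaxwellRarity`)**: for every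
phase point the unit average of (1)'s indicator family IS the finite box sum — no junk `tsum` (contrast
`unitAvg_nbhd_inhom_eq_zero` for the v2 statement `NoMesoscopicOscillation` (ii)). [folklore] -/
theorem mesoStatic_unitAvg_eq_sum : ∀ {σ : ℝ} {N : ℕ} (Φ : Flow σ N) (ϑs ϑh φs c ϑ τ : ℝ) (m₀ : ℕ) (z : Phase N), 0 < c * meanFreePath σ N → 0 < ϑ → unitAvg c σ N τ (fun k q => if Regular ϑs ϑh φs c σ N (Φ.flow ((k : ℝ) * stepLen c σ N) z) q ∧ m₀ ≤ (pop c σ N (Φ.flow ((k : ℝ) * stepLen c σ N) z) q).card ∧ ϑ ≤ relEntAt ϑs c σ N Φ ((k : ℝ) * stepLen c σ N) q z then (1 : ℝ) else 0) = ((numSteps c σ N τ : ℝ))⁻¹ * (c * meanFreePath σ N) ^ 3 * ∑ k ∈ Finset.range (numSteps c σ N τ), ∑ q ∈ cellBox (c * meanFreePath σ N), (if Regular ϑs ϑh φs c σ N (Φ.flow ((k : ℝ) * stepLen c σ N) z) q ∧ m₀ ≤ (pop c σ N (Φ.flow ((k : ℝ) * stepLen c σ N) z) q).card ∧ ϑ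 ≤ relEntAt ϑs c σ N Φ ((k : ℝ) * stepLen c σ N) q z then (1 : ℝ) else 0) := by
  intro σ N Φ ϑs ϑh φs c ϑ τ m₀ z hh hϑ
  exact unitAvg_eq_sum c σ N τ _ fun k _ hq => mesoStatic_summand_eq_zero_of_not_mem hh Φ ϑs ϑh φs m₀ hϑ k z hq

/-- **(2) is box-supported**: off `cellBox h` the increment `badWeight Ψ η T k q` is the zero FUNCTION, so its `G_N`-forecast
`condExp … = 0` everywhere and the summand of `MesoForecastChaos` (`GoodUnit ∧ δ < forecast`) is `0` for `δ ≥ 0`, whatever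
`GoodUnit` says about the junk index. [folklore] -/
theorem mfc_summand_eq_zero_of_not_mem {σ : ℝ} {N : ℕ} {c : ℝ} (hh : 0 < c * meanFreePath σ N) (Φ : Flow σ N)
    (Ψ : V3 × V3 × V3 → ℝ) (η : ℝ) {T δ : ℝ} (hT : 0 ≤ T) (hδ : 0 ≤ δ) (ϑs ϑ φs b : ℝ) (μ : Measure (Phase N)) (k : ℕ)
    (z : Phase N) {q : Cell} (hq : q ∉ cellBox (c * meanFreePath σ N)) :
    (if GoodUnit ϑs ϑ φs c σ N (Φ.flow ((k : ℝ) * stepLen c σ N) z) q ∧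
        δ < MeasureTheory.condExp (MeasurableSpace.comap (seqHist b c σ N Φ k q) ⊤) μ
          (badWeight Ψ η T c σ N Φ k q) z then (1 : ℝ) else 0) = 0 := by
  have hzero : badWeight Ψ η T c σ N Φ k q = 0 := funext fun z' => badWeight_eq_zero_of_not_mem hh Ψ η hT Φ k hq z'
  rw [if_neg]
  rintro ⟨-, h2⟩
  rw [hzero, condExp_zero, Pi.zero_apply] at h2
  exact absurd h2 (not_lt.2 hδ)

/-- **(3) is box-supported**: an ACTUAL kinetic cell `q = cellOf x` lies in `cellBox h`, so off the box the guard of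
`NoKineticIrregularity` fails and its summand is `0` (contrast `NoMesoscopicOscillation` (ii), S5 audit (γ)). [folklore] -/
theorem nki_summand_eq_zero_of_not_mem {σ : ℝ} {N : ℕ} {c : ℝ} (hh : 0 < c * meanFreePath σ N) (Φ : Flow σ N)
    (ϑs ϑ : ℝ) (m₀ : ℕ) (k : ℕ) (z : Phase N) {q : Cell} (hq : q ∉ cellBox (c * meanFreePath σ N)) :
    (if (∃ x : T3, cellOf c σ N x = q) ∧ (nbhd c σ N (Φ.flow ((k : ℝ) * stepLen c σ N) z) q).Nonempty ∧
        (ϑ < inhom ϑs (Φ.flow ((k : ℝ) * stepLen c σ N) z)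
            (pop c σ N (Φ.flow ((k : ℝ) * stepLen c σ N) z) q) (nbhd c σ N (Φ.flow ((k : ℝ) * stepLen c σ N) z) q) ∨
          ((pop c σ N (Φ.flow ((k : ℝ) * stepLen c σ N) z) q).Nonempty ∧
            (pop c σ N (Φ.flow ((k : ℝ) * stepLen c σ N) z) q).card < m₀)) then (1 : ℝ) else 0) = 0 := by
  rw [if_neg]
  rintro ⟨⟨x, hx⟩, -⟩
  exact hq (hx ▸ cellOf_mem_cellBox hh x)

/-- **(4) is box-supported in BOTH indices**: the summand `collPair 1 k q q' z · |…|` of `NoMesoscopicOscillationR` vanishes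
unless `q` and `q'` are both in the box (start cells are cells of sphere positions), for EVERY phase point, good or not
(`collisionPairSum` of the zero summand is `0`). [folklore] -/
theorem nmoR_summand_eq_zero_of_not_mem {σ : ℝ} {N : ℕ} {c : ℝ} (hh : 0 < c * meanFreePath σ N) (Φ : Flow σ N) (k : ℕ)
    (z : Phase N) {q q' : Cell} (hq : q ∉ cellBox (c * meanFreePath σ N) ∨ q' ∉ cellBox (c * meanFreePath σ N)) (R : ℝ) :
    collPair (fun _ => 1) c σ N Φ k q q' z * R = 0 := by
  rw [collPair_eq_zero_of_not_mem hh _ Φ k hq z, zero_mul]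

/-- Hence the inner `∑' q'` of (4) is a finite box sum and the outer family vanishes off the box. [folklore] -/
theorem nmoR_inner_tsum_eq_sum {σ : ℝ} {N : ℕ} {c : ℝ} (hh : 0 < c * meanFreePath σ N) (Φ : Flow σ N) (k : ℕ)
    (z : Phase N) (q : Cell) (R : Cell → ℝ) :
    ∑' q' : Cell, collPair (fun _ => 1) c σ N Φ k q q' z * R q' =
      ∑ q' ∈ cellBox (c * meanFreePath σ N), collPair (fun _ => 1) c σ N Φ k q q' z * R q' :=
  tsum_cell_eq_sum fun q' hq' => nmoR_summand_eq_zero_of_not_mem hh Φ k z (Or.inr hq') (R q')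

/-- … and vanishes identically when the OUTER index is off the box. [folklore] -/
theorem nmoR_inner_tsum_eq_zero_of_not_mem {σ : ℝ} {N : ℕ} {c : ℝ} (hh : 0 < c * meanFreePath σ N) (Φ : Flow σ N)
    (k : ℕ) (z : Phase N) {q : Cell} (hq : q ∉ cellBox (c * meanFreePath σ N)) (R : Cell → ℝ) :
    ∑' q' : Cell, collPair (fun _ => 1) c σ N Φ k q q' z * R q' = 0 := by
  rw [tsum_cell_eq_sum (B := ∅) fun q' _ => nmoR_summand_eq_zero_of_not_mem hh Φ k z (Or.inl hq) (R q')]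
  rfl

/-! ## The degenerate invariant law of an over-packed diameter -/

/-- **Junk channel of `eqLaw` for large `σ`, recorded**: if the canonical partition function vanishes (no admissible
configuration of `N + 1` spheres of diameter `ε_N = σ (N+1)^{-1/3}` on `𝕋³`, e.g. packing `(π/6)σ³` above close packing),
the local Gibbs law — in particular `eqLaw σ N Φ` — is the ZERO measure, under which every `G_N`-large-deviation bound of
(1)/(2) holds trivially. Harmless: both statements quantify `∀ σ, 0 < σ → σ ≤ σ₁`, which includes `σ ≤ 1/2` where the law is
a probability measure (`isProbabilityMeasure_localGibbsLaw`). [folklore] -/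
theorem localGibbsLaw_eq_zero_of_partition_eq_zero {σ : ℝ} (a₀ θ₀ : T3 → ℝ) (u₀ : T3 → V3) (N : ℕ) (Φ : Flow σ N)
    (hZ : canonicalPartition G3 (hsDiameter σ N) (N + 1) (localGibbsProfile a₀ u₀ θ₀) = 0) :
    localGibbsLaw σ a₀ u₀ θ₀ N Φ = 0 := by
  unfold localGibbsLaw particleLaw
  have h : (fun z : Phase N => ENNReal.ofReal (canonicalDensity G3 (hsDiameter σ N) (N + 1) (localGibbsProfile a₀ u₀ θ₀) z)) =
      fun _ => 0 := by
    funext z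
    simp [canonicalDensity, hZ]
  rw [h]
  exact withDensity_zero

end Summit.AtomisticToContinuum.HydrodynamicLimit.Theorems.EquilibriumForecastLine

end
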